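import Summits.AtomisticToContinuum.HydrodynamicLimit.Theorems.InformationPercolationEngineChaosClosesEulerLocalEquilibriumFromDissipationH
import Summits.AtomisticToContinuum.HydrodynamicLimit.Theorems.InformationPercolationEngineKineticClosureBridge
import Summits.AtomisticToContinuum.HydrodynamicLimit.Theorems.InformationPercolationEngineChaosClosesEulerPressureValueN
import Literature.MathematicalPhysics.KineticTheory.HardSphereCanonicalTorus
import HarnessLib

/-!
# Pointwise local equilibrium from the empirical H-theorem (crux `ChaosClosesEuler`, stmt-AtomisticToContinuum-15141,
# line `empirical-h-theorem`, stub `stub_localEquilibriumFromDissipation`) — helper I: the estimate in probability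

WHAT. `localEquilibrium_inProbability`: at fixed `σ < 1/2`, profiles, flow family and `t ≥ 0`, GIVEN — all at this `σ`,
in the vocabulary of helpers A–H (DEFINITIONALLY the `let`s of the skeleton) — the windowed entropy balance (`hWEB`),
pointwise entropic chaos for density weights vanishing on `[η_E/σ³, ∞)` (`hPEnC`), dissipation rigidity (`hDR`,
VERBATIM), the cubic velocity tails at `t` (`hECT`), quartic collision tightness (`hCT`) and the quadratic
collision-moment uniform integrability (`hCM`), and a band `η₁ ≤ min(η_E, η_Y)`: for every bounded continuous `ψ`, every
bounded continuous state weight `h` supported in the bulk with upper density cut `η₁/2`, and `η, δ > 0`, there are `r₀`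
and `N₀(r)` with `P_N(η < ∫₀ᵗ∫ₓ |h(state)| · |M_ψ − ρ_r ∫ψ M_{1,θ_r,u_r}|) ≤ δ`.

ORDER OF THE CHOICES. `ε′`; the tail schedule `Lt` (cubic tails at the levels `ε_j`); rigidity → `η_r, K₁`; `η′`;
chaos → `K₀`; `K = max K₀ K₁` → `L₀, L₁`; the mark constant `C_m = 2A(K, 1, η₁/σ³) + 4` → `ε_C` → `L_C`;
`L = max(L₀, L₁, L_C, 0)` → `r_P` (chaos), `n` (rigidity); tightness → `Kb`; energy → `E₀`; `r₀ = min(r_P, 1/2)`; at fixed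
`r`: entropy balance → `C₁, C₂`; `N₀` = max of the thresholds and of the one making
`Q (t+1) (ε_N |C₁|(1+E₀)³ + 2|C₂| Kb⁺/(N+1)) ≤ η/16`. Off a null set and `4 + (n+1)` bad events: helper F (positivity
transfer), helper G (deterministic core), helper H (budgets).

References: see helpers A–H. No named fact is invoked beyond the hypotheses and the landed helpers.
-/

noncomputable section

namespace Summit.AtomisticToContinuum.HydrodynamicLimit.Theorems.ChaosClosesEulerLocalEquilibriumFromDissipation

open scoped BigOperators Topology Classical MeasureTheory ENNReal InnerProductSpace
open Filter Set MeasureTheory Function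
open Literature.MathematicalPhysics.KineticTheory
open Literature.Analysis.FluidPDE
open Summit.AtomisticToContinuum.HydrodynamicLimit.Theorems.LocalSecondLawNegative
open Summit.AtomisticToContinuum.HydrodynamicLimit.Theorems.LocalSecondLawLedger
open Summit.AtomisticToContinuum.HydrodynamicLimit.Theorems.ChaosClosesEulerStressIsotropy
  (MpsiC sqTail cubeTail ke_eq_configEnergy)
open Summit.AtomisticToContinuum.HydrodynamicLimit.Theorems.ChaosClosesEulerPressureValue (cubeTail_window_event_le)

/-- The tail-event budget algebra: `t (κ d/(t+1))/κ ≤ d` for `t, d ≥ 0`, `κ > 0`. [folklore] -/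
theorem tail_budget_le {t κ d : ℝ} (ht : 0 ≤ t) (hκ : 0 < κ) (hd : 0 ≤ d) : t * (κ * d / (t + 1)) / κ ≤ d := by
  have e : t * (κ * d / (t + 1)) / κ = t / (t + 1) * d := by
    field_simp
  rw [e]
  calc t / (t + 1) * d ≤ 1 * d := mul_le_mul_of_nonneg_right ((div_le_one (by linarith)).2 (by linarith)) hd
    _ = d := one_mul d

/-- **POINTWISE LOCAL EQUILIBRIUM, IN PROBABILITY, AT FIXED `(σ, t)`.** See the module docstring. [folklore] -/
theorem localEquilibrium_inProbability
    {σ : ℝ} (hσ : 0 < σ) (hσ2 : σ < 2⁻¹) {a₀ θ₀ : T3 → ℝ} {u₀ : T3 → V3} (ha : Continuous a₀)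
    (hθc : Continuous θ₀) (hu : Continuous u₀) (ha0 : ∀ x, 0 < a₀ x) (hθ0 : ∀ x, 0 < θ₀ x)
    (Φ : (N : ℕ) → HardSphereFlow (Torus.geometry (Fin 3)) (hsDiameter σ N) (N + 1)) {t : ℝ} (ht : 0 ≤ t)
    {η₁ ηE ηY : ℝ} (hη₁ : 0 < η₁) (hη₁E : η₁ ≤ ηE) (hη₁Y : η₁ ≤ ηY)
    (hYb : ∀ a : ℝ, 0 < a → a ≤ ηY →
      1 / 2 ≤ 3 / (2 * Real.pi) * deriv hsExcessFreeEnergy a ∧ 3 / (2 * Real.pi) * deriv hsExcessFreeEnergy a ≤ 3 / 2)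
    (hWEB : ∀ (τ r δ K : ℝ), 0 < τ → 0 < r → 0 < δ →
      ∀ (h : ℝ → ℝ) (Ch Lh : ℝ), 0 ≤ Ch → 0 ≤ Lh → (∀ a, |h a| ≤ Ch) → (∀ a b, |h a - h b| ≤ Lh * |a - b|) →
      ∃ C₁ C₂ : ℝ, ∀ (N : ℕ) (Φ' : HardSphereFlow (Torus.geometry (Fin 3)) (hsDiameter σ N) (N + 1)),
      ∀ z ∈ Φ'.good, ∀ (t₀ : ℝ) (x₀ : T3),
        |kentW Φ' τ r δ K h z t₀ x₀| ≤ hsDiameter σ N * C₁ * (1 + configEnergy z / (N + 1 : ℝ)) ^ 3 +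
          C₂ * csum Φ' τ (fun s i j => 1 + ‖(Φ'.flow s z i).2‖ ^ 4 + ‖(Φ'.flow s z j).2‖ ^ 4) z / (N + 1 : ℝ))
    (hPEnC : ∀ τ : ℝ, 0 < τ → ∀ δ : ℝ, 0 < δ →
      ∀ h : ℝ → ℝ, Continuous h → (∃ C : ℝ, ∀ a, |h a| ≤ C) → (∀ a : ℝ, ηE ≤ σ ^ 3 * a → h a = 0) →
      ∀ η δ' : ℝ, 0 < η → 0 < δ' → ∃ K₀ : ℝ, ∀ K : ℝ, K₀ ≤ K → ∃ L₀ : ℝ, ∀ L : ℝ, L₀ ≤ L →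
      ∃ r₀ : ℝ, 0 < r₀ ∧ ∀ r : ℝ, 0 < r → r < r₀ → ∃ N₀ : ℕ, ∀ N : ℕ, N₀ ≤ N →
      localGibbsLaw σ a₀ u₀ θ₀ N (Φ N)
        {z | η < ∫ t₀ in Set.Icc 0 τ, ∫ x₀, |krW (Φ N) τ r δ K L h z t₀ x₀ -
          rW (Φ N) σ τ r δ K L h (fun a => 3 / (2 * Real.pi) * deriv hsExcessFreeEnergy a) z t₀ x₀|} ≤ ENNReal.ofReal δ')
    (hDR : ∀ (Lt : ℕ → ℝ) (ρ₁ ρ₂ θ₁ : ℝ), 0 < ρ₁ → 0 < θ₁ →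
        ∀ ψ : V3 → ℝ, Continuous ψ → (∃ C : ℝ, ∀ v, |ψ v| ≤ C) → ∀ δ : ℝ, 0 < δ → ∀ ε : ℝ, 0 < ε →
        ∃ η : ℝ, 0 < η ∧ ∃ K₁ : ℝ, ∀ K : ℝ, K₁ ≤ K → ∃ L₁ : ℝ, ∀ L : ℝ, L₁ ≤ L → ∃ n : ℕ,
        ∀ m : Measure V3, IsFiniteMeasure m → Integrable (fun v : V3 => ‖v‖ ^ 2) m →
          ρ₁ ≤ (m Set.univ).toReal → (m Set.univ).toReal ≤ ρ₂ →
          (∀ j : ℕ, j ≤ n → ∫ v in {v : V3 | Lt j < ‖v‖}, ‖v‖ ^ 2 ∂m ≤ 1 / ((j : ℝ) + 1)) →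
        let φδ : V3 → ℝ := fun v => localMaxwellian 1 (δ ^ 2) 0 v
        let y₀ : V3 → ℝ := fun v => Real.exp (-K) * ((1 + ‖v‖ ^ 2) ^ 2)⁻¹
        let ℓK : V3 → ℝ → ℝ := fun v y => if y₀ v ≤ y then Real.log y else Real.log (y₀ v) + (y - y₀ v) / y₀ v
        let g : V3 → ℝ := fun v => ∫ w, φδ (v - w) ∂m
        let Λt : V3 → ℝ := fun v => ∫ u, φδ (v - u) * ℓK u (g u)
        let Gt : V3 → ℝ := fun v => Real.exp (Λt v)
        let cut : V3 → V3 → ℝ := fun v u => if ‖v‖ ^ 2 + ‖u‖ ^ 2 ≤ L then 1 else 0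
        let D : ℝ := ∫ v, ∫ u, cut v u * (∫ ω : Metric.sphere (0 : V3) 1,
            (Λt v + Λt u - Λt (collide ω (v, u)).1 - Λt (collide ω (v, u)).2) * hardSphereKernel (u, v) ω
              ∂sphereMeasure) * (Gt v * Gt u)
        let ρm : ℝ := (m Set.univ).toReal
        let um : V3 := ρm⁻¹ • ∫ v, v ∂m
        let θm : ℝ := 2 / 3 * ((∫ v, ‖v‖ ^ 2 / 2 ∂m) / ρm - ‖∫ v, v ∂m‖ ^ 2 / (2 * ρm ^ 2))
        θ₁ ≤ θm → D ≤ η → |(∫ v, ψ v ∂m) - ρm * ∫ v, ψ v * localMaxwellian 1 θm um v| ≤ ε)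
    (hECT : ∀ ε : ℝ, 0 < ε → ∃ M : ℝ, ∃ N₀ : ℕ, ∀ N : ℕ, N₀ ≤ N → ∀ s ∈ Set.Icc 0 t,
      ∫⁻ z, ENNReal.ofReal (((N : ℝ) + 1)⁻¹ * ∑ i : Fin (N + 1),
        Set.indicator {v : V3 | M < ‖v‖} (fun v => ‖v‖ ^ 3) (((Φ N).flow s z i).2))
          ∂(localGibbsLaw σ a₀ u₀ θ₀ N (Φ N)) ≤ ENNReal.ofReal ε)
    (hCT : ∀ τ : ℝ, 0 < τ → ∀ δ : ℝ, 0 < δ → ∃ Kb : ℝ, ∃ N₀ : ℕ, ∀ N : ℕ, N₀ ≤ N →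
      localGibbsLaw σ a₀ u₀ θ₀ N (Φ N) {z | Kb < hsDiameter σ N / (N + 1 : ℝ) *
        ∫ m, (1 + ‖m.2.2.2.1‖ ^ 4 + ‖m.2.2.2.2‖ ^ 4) * (1 + 1 / (Real.pi * ‖m.2.2.2.1 - m.2.2.2.2‖))
          ∂((Φ N).empiricalCollisionMeasure (Set.Icc 0 τ) z)} ≤ ENNReal.ofReal δ)
    (hCM : ∀ τ : ℝ, 0 < τ → ∀ η δ : ℝ, 0 < η → 0 < δ → ∃ L : ℝ, ∃ N₀ : ℕ, ∀ N : ℕ, N₀ ≤ N →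
      localGibbsLaw σ a₀ u₀ θ₀ N (Φ N)
        {z | η < csum (Φ N) τ (fun s i j =>
          if L < ‖((Φ N).flow s z i).2‖ ^ 2 + ‖((Φ N).flow s z j).2‖ ^ 2 then
            1 + ‖((Φ N).flow s z i).2‖ ^ 2 + ‖((Φ N).flow s z j).2‖ ^ 2 else 0) z} ≤ ENNReal.ofReal δ)
    (ψ : V3 → ℝ) (hψc : Continuous ψ) (hψb : ∃ C : ℝ, ∀ v, |ψ v| ≤ C)
    (h : ℝ × V3 × ℝ → ℝ) (hhb : ∃ C : ℝ, ∀ p, |h p| ≤ C)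
    (hsupp : ∃ ρ₁ θ₁ Θ U : ℝ, 0 < ρ₁ ∧ 0 < θ₁ ∧ ∀ p : ℝ × V3 × ℝ,
      (p.1 ≤ ρ₁ ∨ η₁ / 2 ≤ σ ^ 3 * p.1 ∨ p.2.2 ≤ θ₁ ∨ Θ ≤ p.2.2 ∨ U ≤ ‖p.2.1‖) → h p = 0)
    {η δ : ℝ} (hη : 0 < η) (hδ : 0 < δ) :
    ∃ r₀ : ℝ, 0 < r₀ ∧ ∀ r : ℝ, 0 < r → r < r₀ → ∃ N₀ : ℕ, ∀ N : ℕ, N₀ ≤ N →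
      localGibbsLaw σ a₀ u₀ θ₀ N (Φ N)
        {z | η < ∫ s in Set.Icc 0 t, ∫ x,
          |h (rhoC r ((Φ N).flow s z) x, uC r ((Φ N).flow s z) x, thetaC r ((Φ N).flow s z) x)| *
            |MpsiC r ((Φ N).flow s z) x ψ - rhoC r ((Φ N).flow s z) x *
              ∫ v, ψ v * localMaxwellian 1 (thetaC r ((Φ N).flow s z) x) (uC r ((Φ N).flow s z) x) v|} ≤
        ENNReal.ofReal δ := by
  obtain ⟨Cψ, hψb⟩ := hψb
  obtain ⟨Ch, hhb⟩ := hhb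
  obtain ⟨ρ₁, θ₁, Θ, U, hρ₁, hθ₁, hsupp⟩ := hsupp
  have hCψ0 : 0 ≤ Cψ := (abs_nonneg _).trans (hψb 0)
  have hCh0 : 0 ≤ Ch := (abs_nonneg _).trans (hhb (0, 0, 0))
  have hσ3 : 0 < σ ^ 3 := pow_pos hσ 3
  have hσ2' : σ ≤ 1 / 2 := by rw [one_div]; exact hσ2.le
  -- the band and the density weight
  set ρv : ℝ := η₁ / σ ^ 3 with hρv
  have hρv0 : 0 < ρv := div_pos hη₁ hσ3
  have hσρv : σ ^ 3 * ρv = η₁ := by rw [hρv]; field_simp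
  have hband : σ ^ 3 * ρv ≤ ηY := by rw [hσρv]; exact hη₁Y
  obtain ⟨hF0, hFabs, hFlow⟩ := weight_facts hYb hρ₁ hρv0 hσ hband
  have hYc : ∀ a, ρ₁ ≤ a → σ ^ 3 * a ≤ η₁ / 2 →
      1 / 2 ≤ rhoW ρ₁ ρv a * (3 / (2 * Real.pi) * deriv hsExcessFreeEnergy (σ ^ 3 * a)) :=
    fun a h1 h2 => hFlow a h1 (by rw [hσρv]; exact h2)
  have hvan : ∀ a : ℝ, ηE ≤ σ ^ 3 * a → rhoW ρ₁ ρv a = 0 := fun a hle =>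
    rhoW_eq_zero_of_ge hρv0 (by rw [hρv, div_le_iff₀ hσ3]; nlinarith)
  have hh0 : ∀ a, ρv ≤ a → rhoW ρ₁ ρv a = 0 := fun a hle => rhoW_eq_zero_of_ge hρv0 hle
  have hYm : Measurable fun a : ℝ => 3 / (2 * Real.pi) * deriv hsExcessFreeEnergy a :=
    (measurable_deriv hsExcessFreeEnergy).const_mul _
  -- ### the tolerances, in order
  set B₀ : ℝ := Ch * (2 * Cψ * (η₁ / 2 / σ ^ 3)) with hB₀
  have hB₀0 : 0 ≤ B₀ := by rw [hB₀]; positivity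
  set ε' : ℝ := η / (4 * (Ch * t + 1)) with hε'
  have hε'0 : 0 < ε' := by rw [hε']; positivity
  -- the tail schedule
  set κ : ℕ → ℝ := fun j => η * (1 / 2) ^ (j + 1) / (4 * (B₀ + 1) * ((j : ℝ) + 1)) with hκ
  have hκ0 : ∀ j, 0 < κ j := fun j => by rw [hκ]; dsimp only; positivity
  set εj : ℕ → ℝ := fun j => κ j * (δ * (1 / 2) ^ (j + 1) / 4) / (t + 1) with hεj
  have hεj0 : ∀ j, 0 < εj j := fun j => by have := hκ0 j; rw [hεj]; dsimp only; positivity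
  choose M NT hMT using fun j => hECT (εj j) (hεj0 j)
  set Lt : ℕ → ℝ := fun j => max (M j) 1 with hLt
  have hLt1 : ∀ j, 1 ≤ Lt j := fun j => le_max_right _ _
  have hLtM : ∀ j, M j ≤ Lt j := fun j => le_max_left _ _
  -- rigidity
  obtain ⟨ηr, hηr, K₁, hK₁⟩ := dr_coneLaw hDR Lt (ρ₂ := η₁ / 2 / σ ^ 3) hρ₁ hθ₁ ψ hψc ⟨Cψ, hψb⟩ one_pos hε'0
  set Qf : ℝ := B₀ * (2 / (ηr * (1 / 2))) * (2 / σ ^ 3) with hQf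
  have hQf0 : 0 ≤ Qf := by rw [hQf]; positivity
  set η' : ℝ := η / (16 * (Qf + 1)) with hη'
  have hη'0 : 0 < η' := by rw [hη']; positivity
  have hδ8 : 0 < δ / 8 := by positivity
  -- chaos
  obtain ⟨K₀, hK₀⟩ := hPEnC (t + 1) (by linarith) 1 one_pos (rhoW ρ₁ ρv) (continuous_rhoW ρ₁ ρv)
    ⟨1, abs_rhoW_le ρ₁ ρv⟩ hvan η' (δ / 8) hη'0 hδ8
  set K : ℝ := max K₀ K₁ with hK
  obtain ⟨L₀, hL₀⟩ := hK₀ K (le_max_left _ _)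
  obtain ⟨L₁, hL₁⟩ := hK₁ K (le_max_right _ _)
  set Cm : ℝ := 1 * (2 * ALam K 1 ρv + 4) with hCm
  have hCm0 : 0 ≤ Cm := by rw [hCm]; have := ALam_nonneg K 1 hρv0.le; positivity
  set εC : ℝ := η / (16 * (Qf + 1) * (Cm + 1)) with hεC
  have hεC0 : 0 < εC := by rw [hεC]; positivity
  obtain ⟨LC, NC, hCM'⟩ := hCM (t + 1) (by linarith) εC (δ / 8) hεC0 hδ8
  set L : ℝ := max (max L₀ L₁) (max LC 0) with hL
  obtain ⟨rP, hrP, hNP⟩ := hL₀ L ((le_max_left _ _).trans (le_max_left _ _))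
  obtain ⟨n, hn⟩ := hL₁ L ((le_max_right _ _).trans (le_max_left _ _))
  have hLC : LC ≤ L := (le_max_left _ _).trans (le_max_right _ _)
  -- tightness and energy
  obtain ⟨Kb, NB, hCT'⟩ := hCT (t + 1) (by linarith) (δ / 8) hδ8
  obtain ⟨E₀, hE₀0, hEev⟩ := KineticClosureBridge.exists_energy_tail_le (u₀ := u₀) ha hθc hu ha0 hθ0 hσ2' hδ8
  -- ### the mollification threshold
  refine ⟨min rP (1 / 2), lt_min hrP (by norm_num), fun r hr hrr₀ => ?_⟩
  have hrP' : r < rP := hrr₀.trans_le (min_le_left _ _)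
  have hr2 : r < 1 / 2 := hrr₀.trans_le (min_le_right _ _)
  -- entropy balance at this `r`
  obtain ⟨C₁, C₂, hWEB'⟩ := hWEB (t + 1) r 1 K (by linarith) hr one_pos (rhoW ρ₁ ρv) 1 (2 / ρ₁ + 2 / ρv) zero_le_one
    (by positivity) (abs_rhoW_le ρ₁ ρv) (abs_rhoW_sub_le hρ₁ hρv0)
  obtain ⟨NP, hNP'⟩ := hNP r hr hrP'
  -- the vanishing entropy-balance bound
  have hev : ∀ᶠ N : ℕ in atTop, Qf * ((t + 1) *
      (hsDiameter σ N * (|C₁| * (1 + E₀) ^ 3) + |C₂| * (2 * max Kb 0) * (1 / ((N : ℝ) + 1)))) < η / 16 := by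
    have h1 : Tendsto (fun N : ℕ => hsDiameter σ N * (|C₁| * (1 + E₀) ^ 3) + |C₂| * (2 * max Kb 0) * (1 / ((N : ℝ) + 1)))
        atTop (𝓝 0) := by
      have ha' := (tendsto_hsDiameter σ).mul_const (|C₁| * (1 + E₀) ^ 3)
      have hb' := (tendsto_one_div_add_atTop_nhds_zero_nat (𝕜 := ℝ)).const_mul (|C₂| * (2 * max Kb 0))
      rw [zero_mul] at ha'; rw [mul_zero] at hb'
      simpa using ha'.add hb'
    have h2 := (h1.const_mul (t + 1)).const_mul Qf
    rw [mul_zero, mul_zero] at h2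
    exact (tendsto_order.1 h2).2 _ (by positivity)
  obtain ⟨N₁, hN₁⟩ := Filter.eventually_atTop.1 hev
  -- ### the particle-number threshold
  refine ⟨max (max NP N₁) (max (max NC NB) ((Finset.range (n + 1)).sup NT)), fun N hN => ?_⟩
  have hNP1 : NP ≤ N := le_trans ((le_max_left _ _).trans (le_max_left _ _)) hN
  have hN₁1 : N₁ ≤ N := le_trans ((le_max_right _ _).trans (le_max_left _ _)) hN
  have hNC1 : NC ≤ N := le_trans (((le_max_left _ _).trans (le_max_left _ _)).trans (le_max_right _ _)) hN
  have hNB1 : NB ≤ N := le_trans (((le_max_right _ _).trans (le_max_left _ _)).trans (le_max_right _ _)) hN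
  have hNT1 : ∀ j ∈ Finset.range (n + 1), NT j ≤ N := fun j hj =>
    le_trans (((Finset.le_sup hj).trans (le_max_right _ _)).trans (le_max_right _ _)) hN
  set P := localGibbsLaw σ a₀ u₀ θ₀ N (Φ N) with hP
  haveI : IsProbabilityMeasure P := isProbabilityMeasure_localGibbsLaw ha hθc hu ha0 hθ0 hσ2' N (Φ N)
  have hPgood : P (Φ N).goodᶜ = 0 := localGibbsLaw_compl_good_eq_zero (Φ N)
  -- ### the bad events
  have hS₁ : P {z | E₀ < ((N : ℝ) + 1)⁻¹ * configEnergy ((Φ N).flow 0 z)} ≤ ENNReal.ofReal (δ / 8) := hEev N (Φ N) 0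
  have hS₂ := hCT' N hNB1
  have hS₃ := hCM' N hNC1
  have hS₄ := hNP' N hNP1
  have hT : ∀ j ∈ Finset.range (n + 1),
      P {z | κ j < ∫ s in (0 : ℝ)..t, ((N : ℝ) + 1)⁻¹ * ∑ i, cubeTail (Lt j) (((Φ N).flow s z) i).2} ≤
        ENNReal.ofReal (δ * (1 / 2) ^ (j + 1) / 4) := by
    intro j hj
    refine (cubeTail_window_event_le (Φ N) hPgood ht (hLtM j) (hεj0 j).le (hκ0 j) (hMT j N (hNT1 j hj))).trans
      (ENNReal.ofReal_le_ofReal ?_)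
    rw [hεj]
    exact tail_budget_le ht (hκ0 j) (by positivity)
  -- ### off the bad events: the pathwise estimate and the budget
  refine (measure_le_of_cover' P hPgood hS₁ hS₂ hS₃ hS₄ hT fun z hz h1 h2 h3 h4 h5 => ?_).trans (prob_budget_le hδ.le n)
  have hzg : z ∈ (Φ N).good := Set.notMem_compl_iff.1 hz
  simp only [Set.mem_setOf_eq, not_lt] at h1 h2 h3 h4 ⊢
  -- energy
  have hEz : configEnergy z / (N + 1 : ℝ) ≤ E₀ := by
    rw [(Φ N).configEnergy_flow hzg 0] at h1
    rw [div_eq_inv_mul]; exact h1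
  have hE0z : 0 ≤ configEnergy z := by unfold configEnergy; positivity
  -- the quartic functional
  have hQ4 : csum (Φ N) (t + 1) (fun s i j => 1 + ‖((Φ N).flow s z i).2‖ ^ 4 + ‖((Φ N).flow s z j).2‖ ^ 4) z ≤
      2 * max Kb 0 := (q4_le (Φ N) hσ hzg (t + 1)).trans (by linarith [h2, le_max_left Kb 0])
  have hz0 : csum (Φ N) (t + 1) (fun _ _ _ => (0 : ℝ)) z = 0 := by
    have h0 := csum_const_mul (Φ N) hzg (t + 1) 0 (fun _ _ _ => (1 : ℝ))
    simp only [zero_mul] at h0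
    exact h0
  have hQ40 : 0 ≤ csum (Φ N) (t + 1) (fun s i j => 1 + ‖((Φ N).flow s z i).2‖ ^ 4 + ‖((Φ N).flow s z j).2‖ ^ 4) z := by
    have hm := csum_mono (Φ N) hzg hσ (τ := t + 1) (F := fun _ _ _ => (0 : ℝ))
      (G := fun s i j => 1 + ‖((Φ N).flow s z i).2‖ ^ 4 + ‖((Φ N).flow s z j).2‖ ^ 4) (fun s _ i j => by positivity)
    rw [hz0] at hm
    exact hm
  -- the entropy-balance bound on every window
  set W : ℝ := hsDiameter σ N * (|C₁| * (1 + E₀) ^ 3) + |C₂| * (2 * max Kb 0) * (1 / ((N : ℝ) + 1)) with hW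
  have hWz : ∀ t₀ x₀, |kentW (Φ N) (t + 1) r 1 K (rhoW ρ₁ ρv) z t₀ x₀| ≤ W := by
    intro t₀ x₀
    refine (hWEB' N (Φ N) z hzg t₀ x₀).trans ?_
    have hε := (hsDiameter_pos hσ N).le
    have hN1 : (0 : ℝ) < (N : ℝ) + 1 := by positivity
    have hX0 : 0 ≤ configEnergy z / (N + 1 : ℝ) := div_nonneg hE0z hN1.le
    have hX3 : 0 ≤ (1 + configEnergy z / (N + 1 : ℝ)) ^ 3 := pow_nonneg (by linarith) 3
    have h1' : hsDiameter σ N * C₁ * (1 + configEnergy z / (N + 1 : ℝ)) ^ 3 ≤ hsDiameter σ N * (|C₁| * (1 + E₀) ^ 3) := by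
      rw [mul_assoc]
      refine mul_le_mul_of_nonneg_left ?_ hε
      have hc : (1 + configEnergy z / (N + 1 : ℝ)) ^ 3 ≤ (1 + E₀) ^ 3 :=
        pow_le_pow_left₀ (by linarith) (by linarith) 3
      calc C₁ * (1 + configEnergy z / (N + 1 : ℝ)) ^ 3 ≤ |C₁| * (1 + configEnergy z / (N + 1 : ℝ)) ^ 3 :=
            mul_le_mul_of_nonneg_right (le_abs_self _) hX3
        _ ≤ |C₁| * (1 + E₀) ^ 3 := mul_le_mul_of_nonneg_left hc (abs_nonneg _)
    have h2' : C₂ * csum (Φ N) (t + 1) (fun s i j => 1 + ‖((Φ N).flow s z i).2‖ ^ 4 + ‖((Φ N).flow s z j).2‖ ^ 4) z /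
        (N + 1 : ℝ) ≤ |C₂| * (2 * max Kb 0) * (1 / ((N : ℝ) + 1)) := by
      rw [mul_one_div, div_le_div_iff_of_pos_right hN1]
      exact (mul_le_mul_of_nonneg_right (le_abs_self _) hQ40).trans (mul_le_mul_of_nonneg_left hQ4 (abs_nonneg _))
    exact add_le_add h1' h2'
  have hωN : Qf * ((t + 1) * W) ≤ η / 16 := (hN₁ N hN₁1).le
  -- the quadratic collision-moment functional at level `L ≥ L_C`
  have hCMz : csum (Φ N) (t + 1) (fun s i j =>
      if L < ‖((Φ N).flow s z i).2‖ ^ 2 + ‖((Φ N).flow s z j).2‖ ^ 2 then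
        1 + ‖((Φ N).flow s z i).2‖ ^ 2 + ‖((Φ N).flow s z j).2‖ ^ 2 else 0) z ≤ εC := by
    refine le_trans (csum_mono (Φ N) hzg hσ fun s _ i j => ?_) h3
    by_cases hq : L < ‖((Φ N).flow s z i).2‖ ^ 2 + ‖((Φ N).flow s z j).2‖ ^ 2
    · rw [if_pos hq, if_pos (hLC.trans_lt hq)]
    · rw [if_neg hq]; split_ifs <;> positivity
  -- positivity transfer (helper F)
  have htr := predField_window_le (Φ N) hzg hσ hr hr2 one_pos K L ht (by linarith : t + r ≤ t + 1)
    (continuous_rhoW ρ₁ ρv) hYm (abs_rhoW_le ρ₁ ρv) hFabs hF0 hh0 hρv0.le hWz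
  -- the tails off the tail events
  have htails : ∀ j ∈ Finset.range (n + 1),
      ∫ s in Set.Icc 0 t, ((N : ℝ) + 1)⁻¹ * ∑ i, cubeTail (Lt j) (((Φ N).flow s z) i).2 ≤ κ j := by
    intro j hj
    have h6 := h5 j hj
    simp only [Set.mem_setOf_eq, not_lt] at h6
    rwa [intervalIntegral.integral_of_le ht, ← integral_Icc_eq_integral_Ioc] at h6
  -- the deterministic core (helper G)
  have hcore := core_integral_le (Φ N) hzg hσ hr hr2 one_pos K L ht hψb
    (fun θ hθ u => abs_maxwellMoment_le' hψc hψb hθ u) hhb hθ₁ (by positivity : (0 : ℝ) ≤ η₁ / 2) hsupp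
    (continuous_rhoW ρ₁ ρv) hYm hFabs hh0 hρv0.le hF0 (by norm_num : (0 : ℝ) < 1 / 2) hYc hLt1 hηr hε'0.le
    (hn N r hr)
  rw [← hB₀] at hcore
  -- the budget (helper H)
  have hbudget := budget_le' (B₀ := B₀) (Q := Qf) (Cm := Cm) (ω := (t + 1) * W) hη ht hCh0 hB₀0 hQf0 hCm0 hωN n
  refine hcore.trans (le_trans ?_ hbudget)
  have hsum : B₀ * ∑ j ∈ Finset.range (n + 1), ((j : ℝ) + 1) *
      ∫ s in Set.Icc 0 t, ((N : ℝ) + 1)⁻¹ * ∑ i, cubeTail (Lt j) (((Φ N).flow s z) i).2 ≤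
      B₀ * ∑ j ∈ Finset.range (n + 1), ((j : ℝ) + 1) * (η * (1 / 2) ^ (j + 1) / (4 * (B₀ + 1) * ((j : ℝ) + 1))) :=
    mul_le_mul_of_nonneg_left (Finset.sum_le_sum fun j hj =>
      mul_le_mul_of_nonneg_left (htails j hj) (by positivity)) hB₀0
  have hmid : B₀ * (2 / (ηr * (1 / 2))) * ∫ s in Set.Icc 0 t, ∫ x,
      predField (Φ N) σ r 1 K L (rhoW ρ₁ ρv) (fun a => 3 / (2 * Real.pi) * deriv hsExcessFreeEnergy a) z s x ≤
      Qf * (η' + Cm * εC + (t + 1) * W) := by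
    rw [hQf, mul_assoc (B₀ * (2 / (ηr * (1 / 2))))]
    refine mul_le_mul_of_nonneg_left (htr.trans (mul_le_mul_of_nonneg_left ?_ (by positivity))) (by positivity)
    refine add_le_add (add_le_add h4 ?_) le_rfl
    rw [hCm]
    exact mul_le_mul_of_nonneg_left hCMz (mul_nonneg zero_le_one (by linarith [ALam_nonneg K 1 hρv0.le]))
  have e1 : Ch * ε' * t = Ch * (η / (4 * (Ch * t + 1))) * t := by rw [hε']
  have e2 : η' + Cm * εC + (t + 1) * W = η / (16 * (Qf + 1)) + Cm * (η / (16 * (Qf + 1) * (Cm + 1))) + (t + 1) * W := by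
    rw [hη', hεC]
  rw [e2] at hmid
  linarith [hmid, hsum, e1]

/-- **Registered sub-goal `stub_localEquilibriumFromDissipationI` (helper I of `stub_localEquilibriumFromDissipation`):
the tail-event budget algebra** — `t (κ d/(t+1))/κ ≤ d` for `t, d ≥ 0`, `κ > 0`. [folklore] -/
theorem stub_localEquilibriumFromDissipationI : ∀ (t κ d : ℝ), 0 ≤ t → 0 < κ → 0 ≤ d → t * (κ * d / (t + 1)) / κ ≤ d :=
  fun _ _ _ ht hκ hd => tail_budget_le ht hκ hd

end Summit.AtomisticToContinuum.HydrodynamicLimit.Theorems.ChaosClosesEulerLocalEquilibriumFromDissipation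

end
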